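import Literature.MathematicalPhysics.QuantumFieldTheory.StrongCouplingActivities
import HarnessLib

/-!
# The link-free (Vairinhos–de Forcrand) representation of Wilson lattice gauge theory

Topic `Literature/MathematicalPhysics/QuantumLattice`.  Vairinhos–de Forcrand, *Lattice gauge theory
without link variables*, JHEP 12 (2014) 038 (arXiv:1409.8442) rewrite the partition function of
pure `SU(N)`/`U(N)` lattice gauge theory with the Wilson plaquette action by two Hubbard–Stratonovich
(HS) transformations, after which every link variable enters the weight LINEARLY and is integrated
out exactly against the one-link (Brézin–Gross–Witten) integral; what is left is a positive weight
on Gaussian auxiliary matrix fields living on the plaquettes (the "0-link action").  This file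
defines that representation for the tree's finite-volume Wilson theory (`QuantumFieldTheory.wilsonWeight`:
torus `(ℤ/L)^d`, compact gauge group `G`, matrix representation `ρ : G →* M_N(ℂ)`, weight
`exp(-β ∑ₚ (N - Re tr ρ(U_p)))`), with PLAQUETTE-DEPENDENT couplings `β : Plaquette d L → ℝ`:

* `oneLinkIntegral ρ J = ∫_G exp(2 Re tr(J ρ(U))) dU` (VdF's `𝓘_G`; Bars 1980,
  Eriksson–Svartholm–Skagerstam 1981): positivity, bi-invariance `J ↦ ρ(a) J ρ(b)`, continuity;
* `VdFConfig d L N` — for every plaquette `p = (x; i<j)` three complex `N × N` matrices `Q_p` (VdF's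
  "diagonal link"), `R_p`, `R'_p` (the "folded links" of the half-plaquettes `U(x,i)U(x+eᵢ,j)` and
  `U(x,j)U(x+eⱼ,i)`), stored entrywise: a finite product of copies of `ℂ` with product Lebesgue
  measure `volume` and product Borel structure (no instance on `Matrix` is declared);
* `VdFConfig.source X ℓ = J_ℓ` — the source seen by the link `ℓ`: the sum over the plaquettes `p ∋ ℓ`
  of `R_p Q_pᴴ`, `R_pᴴ`, `R'_p Q_pᴴ`, `R'_pᴴ` according to the role of `ℓ` in `p`;
* `vdfDensity ρ β X = ∏ₚ exp(-(2/β_p + 2)‖Q_p‖² - ‖R_p‖² - ‖R'_p‖²) · ∏_ℓ oneLinkIntegral ρ (J_ℓ X)`,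
  the un-normalised DUAL MEASURE `vdfDualMeasure ρ β = volume.withDensity vdfDensity`, its total
  mass `vdfDualPartition` (`> 0`) and the normalised law `vdfDualLaw`;
* `vdfNormalisation N β = ∏ₚ 2^{N²} π^{-3N²} β_p^{-N²} e^{-2N(β_p+1)}`, the explicit constant of the
  identity `Z_Wilson(β) = N₀ · Z_dual(β)` derived below.  That identity, the source dictionary for
  Wilson loops (VdF's "effective links") and `∂_{β_p} log Z_dual = (2/β_p²)⟨‖Q_p‖²⟩` are
  CONSTRUCTION statements about these objects, deliberately NOT asserted here (route items of the
  requesting line), as are the quark extension (VdF, Discussion) and the character expansion of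
  `oneLinkIntegral` (Bars 1980; Balantekin 2000).

## Derivation and normalisation (why these constants)

`‖M‖² = Re tr(Mᴴ M)`, `dQ` = Lebesgue measure on `M_N(ℂ) ≅ ℝ^{2N²}`, so that
`∫ exp(-a‖Q‖² + 2 Re tr(Qᴴ M)) dQ = (π/a)^{N²} exp(‖M‖²/a)` (`a > 0`).  The tree's `β` is VdF's `β/N`;
our `Q_p` is VdF's rescaled so that `β_p` enters ONLY through its Gaussian width, and our kernel is
`exp(2 Re tr(J U))` (VdF: `exp((β/N) Re tr(Jᴴ U))`).  Fix `p = (x; i<j)`, `U₁ = U(x,i)`,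
`U₂ = U(x+eᵢ,j)`, `U₃ = U(x+eⱼ,i)`, `U₄ = U(x,j)`, `U_p = U₁U₂U₃⁻¹U₄⁻¹` (`plaquetteHolonomy`), and
assume `ρ(G) ⊆ U(N)`.
(1) `X = ρ(U₁U₂)`, `Y = ρ(U₄U₃)`: `‖X + Y‖² = 2N + 2 Re tr ρ(U_p)`, so
`exp(-β(N - Re tr ρ(U_p))) = e^{-2βN} exp((β/2)‖X+Y‖²)`.
(2) First HS (`a = 2/β`): `exp((β/2)‖X+Y‖²) = (2/(πβ))^{N²} ∫ dQ e^{-(2/β)‖Q‖²} e^{2Re tr(QᴴX)} e^{2Re tr(QᴴY)}`.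
(3) Second HS per half-plaquette (`a = 1`, `M = ρ(U₁)ᴴQ + ρ(U₂)`, unitarity twice):
`e^{2Re tr(Qᴴρ(U₁)ρ(U₂))} = π^{-N²} e^{-‖Q‖²-N} ∫ dR e^{-‖R‖²} e^{2Re tr((RQᴴ)ρ(U₁))} e^{2Re tr(Rᴴρ(U₂))}`,
and likewise for `Y` with `R'`: `U₄` gets `R'Qᴴ`, `U₃` gets `R'ᴴ`.
(4) Each link variable now appears only in `exp(2 Re tr(J_ℓ ρ(U_ℓ)))`, `J_ℓ` the sum of its source
terms, and `∫ ∏_ℓ dU_ℓ` factorises into `∏_ℓ oneLinkIntegral ρ J_ℓ` (Tonelli, everything is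
non-negative).  Constants per plaquette: `e^{-2βN} (2/(πβ))^{N²} (π^{-N²} e^{-N})²
= 2^{N²} π^{-3N²} β^{-N²} e^{-2N(β+1)}` = `vdfNormalisation`.  (Sanity check made when writing this
file: for `G = U(1)`, `N = 1`, `d = 2`, `L = 1` the identity reads
`E[I₀(2|RQ̄+R̄'|) I₀(2|R̄+R'Q̄|)] = (1+β)e^{2(1+β)}` over independent complex Gaussians; importance-
sampled Monte Carlo confirms it to `0.3%` at `β = 0.3` and `1%` at `β = 1`.)

## Design choices

* Generality of the tree: abstract compact `G` and `ρ`; the paper's cases are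
  `ρ = fundamentalRep (Fin N)` (`SU(N)`) and `unitaryFundamentalRep (Fin N) ℂ` (`U(N)`).  The HS
  identities need `ρ(G) ⊆ U(N)`; the definitions do not.  `β_p ≤ 0` is junk (`2/0 = 0`).
* `J_ℓ` is a sum over ALL plaquettes of indicator-weighted terms (no enumeration of the `2(d-1)`
  plaquettes containing `ℓ`); on small tori (`L ≤ 2`) a link can play two roles in one plaquette
  and the terms then correctly add up.
* No finiteness instance for `vdfDualMeasure`: `Z_dual = Z_Wilson/N₀ < ∞` is the content of the
  (unproved here) identity; direct Gaussian domination only works for `β_p < 1/(N-1)`.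

## References

* H. Vairinhos, Ph. de Forcrand, JHEP 12 (2014) 038, arXiv:1409.8442, §§"Gaussian measures",
  "2-link action", "1-link action", "0-link action", "Observables". [VairinhosDeforcrand2014]
* I. Bars, J. Math. Phys. 21 (1980) 2678 [Bars1980]; K. E. Eriksson, N. Svartholm,
  B. S. Skagerstam, J. Math. Phys. 22 (1981) 2276 [ErikssonSvartholmSkagerstam1981];
  J. Budczies, M. R. Zirnbauer, math-ph/0305058 [BudcziesZirnbauer2003].
-/

noncomputable section

open MeasureTheory
open scoped Matrix ComplexConjugate ComplexOrder

namespace Literature.MathematicalPhysics.QuantumLattice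

open QuantumFieldTheory (Site Edge Plaquette haarProbability)

/-! ## The one-link integral -/

section OneLink

variable {N : ℕ} {G : Type*} [Group G] [TopologicalSpace G] [IsTopologicalGroup G] [CompactSpace G]
  [MeasurableSpace G] [BorelSpace G] (ρ : G →* Matrix (Fin N) (Fin N) ℂ)

/-- The **one-link integral** (Brézin–Gross–Witten integral) of lattice gauge theory with an
external source `J ∈ M_N(ℂ)`: `W(J) = ∫_G exp(2 Re tr(J ρ(U))) dU` against the normalised Haar
measure of the compact gauge group `G` in the representation `ρ` (for `SU(N)`, `U(N)` take
`ρ = fundamentalRep`, `unitaryFundamentalRep`).  Vairinhos–de Forcrand's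
`𝓘_G(J, J†) = ∫ dU exp(tr(J U† + U J†)) = ∫ dU exp(2 Re tr(J† U))` is `oneLinkIntegral ρ Jᴴ`.
[cite: VairinhosDeforcrand2014, §"0-link action", eq. (𝓘_G)] -/
def oneLinkIntegral (J : Matrix (Fin N) (Fin N) ℂ) : ℝ :=
  ∫ U, Real.exp (2 * (J * ρ U).trace.re) ∂haarProbability G

/-- `W(0) = 1` (Haar measure is a probability measure). [folklore] -/
@[simp] theorem oneLinkIntegral_zero : oneLinkIntegral ρ (0 : Matrix (Fin N) (Fin N) ℂ) = 1 := by
  unfold oneLinkIntegral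
  simp only [Matrix.zero_mul, Matrix.trace_zero, Complex.zero_re, mul_zero, Real.exp_zero]
  rw [integral_const, probReal_univ, one_smul]

/-- `W(J) ≥ 0`. [folklore] -/
theorem oneLinkIntegral_nonneg (J : Matrix (Fin N) (Fin N) ℂ) : 0 ≤ oneLinkIntegral ρ J :=
  integral_nonneg fun _ => (Real.exp_pos _).le

omit [IsTopologicalGroup G] [CompactSpace G] [MeasurableSpace G] [BorelSpace G] in
/-- The integrand `(J, U) ↦ exp(2 Re tr(J ρ(U)))` is jointly continuous for continuous `ρ`.
[folklore] -/
theorem continuous_oneLinkIntegrand (hρ : Continuous ρ) :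
    Continuous (Function.uncurry fun (J : Matrix (Fin N) (Fin N) ℂ) (U : G) =>
      Real.exp (2 * (J * ρ U).trace.re)) := by
  have h1 : Continuous fun q : Matrix (Fin N) (Fin N) ℂ × G => q.1 * ρ q.2 :=
    continuous_fst.matrix_mul (hρ.comp continuous_snd)
  exact Real.continuous_exp.comp (continuous_const.mul (Complex.continuous_re.comp h1.matrix_trace))

/-- For continuous `ρ` the one-link integrand is Haar integrable (continuous on a compact group).
[folklore] -/
theorem integrable_oneLinkIntegrand (hρ : Continuous ρ) (J : Matrix (Fin N) (Fin N) ℂ) :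
    Integrable (fun U : G => Real.exp (2 * (J * ρ U).trace.re)) (haarProbability G) := by
  have hc : Continuous fun U : G => Real.exp (2 * (J * ρ U).trace.re) :=
    Real.continuous_exp.comp (continuous_const.mul
      (Complex.continuous_re.comp (continuous_const.matrix_mul hρ).matrix_trace))
  exact hc.integrable_of_hasCompactSupport (HasCompactSupport.of_compactSpace _)

/-- `W(J) > 0` for continuous `ρ`. [folklore] -/
theorem oneLinkIntegral_pos (hρ : Continuous ρ) (J : Matrix (Fin N) (Fin N) ℂ) :
    0 < oneLinkIntegral ρ J :=
  integral_exp_pos (integrable_oneLinkIntegrand ρ hρ J)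

/-- **Bi-invariance** of the one-link integral under the gauge group:
`W(ρ(a) J ρ(b)) = W(J)` (substitute `U ↦ b U a` in the bi-invariant Haar integral; this is the
gauge covariance of the link-free representation, VdF: "the auxiliary variables transform
covariantly"). [cite: VairinhosDeforcrand2014, §"0-link action"] -/
theorem oneLinkIntegral_conj (J : Matrix (Fin N) (Fin N) ℂ) (a b : G) :
    oneLinkIntegral ρ (ρ a * J * ρ b) = oneLinkIntegral ρ J := by
  unfold oneLinkIntegral
  have h : ∀ U : G, (ρ a * J * ρ b * ρ U).trace = (J * ρ (b * U * a)).trace := fun U => by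
    rw [map_mul, map_mul]
    simp only [Matrix.mul_assoc]
    conv_lhs => rw [Matrix.trace_mul_comm]
    simp only [Matrix.mul_assoc]
  simp_rw [h]
  exact QuantumFieldTheory.integral_haar_conj_eq
    (fun U : G => Real.exp (2 * (J * ρ U).trace.re)) b a

/-- **Continuity** of `J ↦ W(J)` for continuous `ρ` (a parametric integral of a jointly
continuous integrand over a compact group). [folklore] -/
theorem continuous_oneLinkIntegral (hρ : Continuous ρ) : Continuous (oneLinkIntegral (G := G) ρ) := by
  haveI : FirstCountableTopology (Matrix (Fin N) (Fin N) ℂ) :=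
    inferInstanceAs (FirstCountableTopology (Fin N → Fin N → ℂ))
  haveI : LocallyCompactSpace (Matrix (Fin N) (Fin N) ℂ) :=
    inferInstanceAs (LocallyCompactSpace (Fin N → Fin N → ℂ))
  have h := continuous_parametric_integral_of_continuous (μ := haarProbability G)
    (continuous_oneLinkIntegrand ρ hρ) isCompact_univ
  simp only [Measure.restrict_univ] at h
  exact h

/-- For `U(N)` in its defining representation, `oneLinkIntegral` is literally
`∫_{U(N)} exp(2 Re tr(J U)) dU`, the `W(J)` of the route items on `U(3)`. [folklore] -/
theorem oneLinkIntegral_unitaryGroup (J : Matrix (Fin N) (Fin N) ℂ) :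
    oneLinkIntegral (unitaryFundamentalRep (Fin N) ℂ) J =
      ∫ U, Real.exp (2 * (J * (U : Matrix (Fin N) (Fin N) ℂ)).trace.re)
        ∂haarProbability (Matrix.unitaryGroup (Fin N) ℂ) := rfl

/-- For `SU(N)` in its defining representation, `oneLinkIntegral` is literally
`∫_{SU(N)} exp(2 Re tr(J U)) dU`. [folklore] -/
theorem oneLinkIntegral_specialUnitaryGroup (J : Matrix (Fin N) (Fin N) ℂ) :
    oneLinkIntegral (fundamentalRep (Fin N)) J =
      ∫ U, Real.exp (2 * (J * (U : Matrix (Fin N) (Fin N) ℂ)).trace.re)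
        ∂haarProbability (Matrix.specialUnitaryGroup (Fin N) ℂ) := rfl

end OneLink

/-! ## Auxiliary-field configurations -/

/-- The three species of Vairinhos–de Forcrand auxiliary fields attached to a plaquette
`p = (x; i<j)`: `diag` is the "diagonal link" `Q_p` of the first HS transformation, `fold₁` and
`fold₂` are the "folded links" `R_p`, `R'_p` of the second HS transformation applied to the two
half-plaquettes `U(x,i)U(x+eᵢ,j)` and `U(x,j)U(x+eⱼ,i)`.
[cite: VairinhosDeforcrand2014, §§"2-link action", "1-link action", Fig. 1] -/
inductive AuxField : Type
  | diag
  | fold₁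
  | fold₂
  deriving DecidableEq, Fintype, Inhabited

/-- Configurations of the link-free representation on the torus `(ℤ/L)^d` with `N` colours: for
every plaquette and species an `N × N` complex matrix, stored entrywise.  As a finite product of
copies of `ℂ` it carries the product Borel σ-algebra and the product Lebesgue measure `volume`
(`= ∏ dRe dIm` over all entries). [cite: VairinhosDeforcrand2014, §"0-link action"] -/
abbrev VdFConfig (d L N : ℕ) : Type :=
  Plaquette d L × AuxField × Fin N × Fin N → ℂ

namespace VdFConfig

variable {d L N : ℕ}

/-- The diagonal-link field `Q_p ∈ M_N(ℂ)` of the plaquette `p`. [cite: VairinhosDeforcrand2014, §"2-link action"] -/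
def Q (X : VdFConfig d L N) (p : Plaquette d L) : Matrix (Fin N) (Fin N) ℂ :=
  Matrix.of fun a b => X (p, .diag, a, b)

/-- The folded-link field `R_p ∈ M_N(ℂ)` of the half-plaquette `U(x,i)U(x+eᵢ,j)` of `p = (x;i<j)`.
[cite: VairinhosDeforcrand2014, §"1-link action"] -/
def R (X : VdFConfig d L N) (p : Plaquette d L) : Matrix (Fin N) (Fin N) ℂ :=
  Matrix.of fun a b => X (p, .fold₁, a, b)

/-- The folded-link field `R'_p ∈ M_N(ℂ)` of the half-plaquette `U(x,j)U(x+eⱼ,i)` of `p = (x;i<j)`.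
[cite: VairinhosDeforcrand2014, §"1-link action"] -/
def R' (X : VdFConfig d L N) (p : Plaquette d L) : Matrix (Fin N) (Fin N) ℂ :=
  Matrix.of fun a b => X (p, .fold₂, a, b)

/-- Entries of `Q_p`. [folklore] -/
@[simp] theorem Q_apply (X : VdFConfig d L N) (p : Plaquette d L) (a b : Fin N) :
    X.Q p a b = X (p, .diag, a, b) := rfl

/-- Entries of `R_p`. [folklore] -/
@[simp] theorem R_apply (X : VdFConfig d L N) (p : Plaquette d L) (a b : Fin N) :
    X.R p a b = X (p, .fold₁, a, b) := rfl

/-- Entries of `R'_p`. [folklore] -/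
@[simp] theorem R'_apply (X : VdFConfig d L N) (p : Plaquette d L) (a b : Fin N) :
    X.R' p a b = X (p, .fold₂, a, b) := rfl

/-- The **dual plaquette energy** `‖Q_p‖² = Re tr(Q_pᴴ Q_p) = Σ_{ab} |(Q_p)_{ab}|²`, the observable
conjugate to the coupling `β_p` in the dual weight (VdF express the energy density through
`⟨tr(Q Q†)⟩`, `⟨tr(R R†)⟩` and `∂_β log 𝓘_G`). [cite: VairinhosDeforcrand2014, §"Observables"] -/
def plaqEnergy (X : VdFConfig d L N) (p : Plaquette d L) : ℝ :=
  ((X.Q p)ᴴ * X.Q p).trace.re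

/-- `‖Q_p‖² ≥ 0`. [folklore] -/
theorem plaqEnergy_nonneg (X : VdFConfig d L N) (p : Plaquette d L) : 0 ≤ X.plaqEnergy p := by
  show 0 ≤ ((X.Q p)ᴴ * X.Q p).trace.re
  have h : (0 : ℂ) ≤ ((X.Q p)ᴴ * X.Q p).trace := by
    rw [← Matrix.star_vec_dotProduct_vec]
    exact dotProduct_star_self_nonneg _
  have h2 := (Complex.le_def.1 h).1
  rwa [Complex.zero_re] at h2

variable [NeZero L]

/-- The **source** `J_ℓ ∈ M_N(ℂ)` seen by the link `ℓ` after both HS transformations: writing the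
plaquette `p = (x; i<j)` as `U_p = U₁U₂U₃⁻¹U₄⁻¹` with `U₁ = U(x,i)`, `U₂ = U(x+eᵢ,j)`,
`U₃ = U(x+eⱼ,i)`, `U₄ = U(x,j)`, the link `ℓ` receives from `p` the term `R_p Q_pᴴ` if `ℓ = U₁`,
`R_pᴴ` if `ℓ = U₂`, `R'_p Q_pᴴ` if `ℓ = U₄` and `R'_pᴴ` if `ℓ = U₃`, and `J_ℓ` is the sum of these
over all plaquettes (each link lies in `2(d-1)` plaquettes).  This is VdF's `J_{x,μ}` (the
display after `S₁`: a sum over `ν ≠ μ` of the folded link of the plaquette behind `ℓ` times a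
diagonal link, plus the folded link of the plaquette in front), written in the kernel convention
`exp(2 Re tr(J_ℓ ρ(U_ℓ)))` of `oneLinkIntegral` and with the folded links paired with the
half-plaquettes as in the module docstring (an equivalent choice of HS variables).
[cite: VairinhosDeforcrand2014, §"1-link action", eq. (J_{x,μ})] -/
def source (X : VdFConfig d L N) (ℓ : Edge d L) : Matrix (Fin N) (Fin N) ℂ :=
  ∑ p : Plaquette d L,
    ((if ℓ = (p.1, p.2.1.1) then X.R p * (X.Q p)ᴴ else 0) +
      (if ℓ = (p.1.shift p.2.1.1, p.2.1.2) then (X.R p)ᴴ else 0) +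
      (if ℓ = (p.1, p.2.1.2) then X.R' p * (X.Q p)ᴴ else 0) +
      (if ℓ = (p.1.shift p.2.1.2, p.2.1.1) then (X.R' p)ᴴ else 0))

end VdFConfig

/-! ## The dual weight and the dual measure -/

section Dual

variable {d L N : ℕ} [NeZero L] {G : Type*} [Group G] [TopologicalSpace G] [IsTopologicalGroup G]
  [CompactSpace G] [MeasurableSpace G] [BorelSpace G] (ρ : G →* Matrix (Fin N) (Fin N) ℂ)

/-- The Gaussian part of the dual weight,
`∏ₚ exp(-(2/β_p + 2)‖Q_p‖² - ‖R_p‖² - ‖R'_p‖²)` with `‖M‖² = Re tr(Mᴴ M)` (`‖Q_p‖² = plaqEnergy`):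
the coupling `β_p` enters only through the width of `Q_p` (first HS transformation with parameter
`2/β_p`; the `+2` and the unit widths of `R_p, R'_p` come from the two second HS transformations).
Junk for `β_p ≤ 0`. [cite: VairinhosDeforcrand2014, §"0-link action", eq. (Z, 0-link)] -/
def vdfGaussWeight (β : Plaquette d L → ℝ) (X : VdFConfig d L N) : ℝ :=
  ∏ p : Plaquette d L,
    Real.exp (-((2 / β p + 2) * X.plaqEnergy p + ((X.R p)ᴴ * X.R p).trace.re +
      ((X.R' p)ᴴ * X.R' p).trace.re))

/-- The **dual (0-link) weight** of Vairinhos–de Forcrand: Gaussian part times the product over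
all links of the one-link integrals of their sources,
`vdfGaussWeight β X · ∏_ℓ oneLinkIntegral ρ (J_ℓ X)` (`= γ[Q] γ[R] e^{-S₀}` up to our
normalisation, `S₀ = -Σ_ℓ log 𝓘_G`). [cite: VairinhosDeforcrand2014, §"0-link action", eqs. (Z, 0-link), (S₀)] -/
def vdfDensity (β : Plaquette d L → ℝ) (X : VdFConfig d L N) : ℝ :=
  vdfGaussWeight β X * ∏ ℓ : Edge d L, oneLinkIntegral ρ (X.source ℓ)

/-- The **link-free dual measure** of the Wilson lattice gauge theory with plaquette couplings
`β`: the un-normalised measure `vdfDensity ρ β · dvolume` on the auxiliary fields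
(`volume` = Lebesgue measure on all matrix entries).  For `ρ(G) ⊆ U(N)` and `β_p > 0` its total
mass is `Z_Wilson(β)/vdfNormalisation N β` (VdF's 0-link representation of the partition function;
not asserted here). [cite: VairinhosDeforcrand2014, §"0-link action", eq. (Z, 0-link)] -/
def vdfDualMeasure (β : Plaquette d L → ℝ) : Measure (VdFConfig d L N) :=
  volume.withDensity fun X => ENNReal.ofReal (vdfDensity ρ β X)

/-- The dual partition function `Z_dual(β) = ∫ vdfDensity dvolume ∈ [0, ∞]`.
[cite: VairinhosDeforcrand2014, §"0-link action"] -/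
def vdfDualPartition (β : Plaquette d L → ℝ) : ENNReal :=
  vdfDualMeasure (d := d) (L := L) ρ β Set.univ

/-- The normalised dual law `ν_β = Z_dual⁻¹ · vdfDualMeasure` of the auxiliary fields (a
probability measure as soon as `0 < Z_dual < ∞`). [cite: VairinhosDeforcrand2014, §"0-link action"] -/
def vdfDualLaw (β : Plaquette d L → ℝ) : Measure (VdFConfig d L N) :=
  (vdfDualPartition (d := d) (L := L) ρ β)⁻¹ • vdfDualMeasure ρ β

/-- The explicit constant `N₀(β) = ∏ₚ 2^{N²} π^{-3N²} β_p^{-N²} e^{-2N(β_p + 1)}` for which the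
HS derivation in the module docstring gives `Z_Wilson(β) = N₀(β) · Z_dual(β)` when `ρ(G) ⊆ U(N)`
and all `β_p > 0` (our normalisation; VdF's `𝒩₀` differs by their rescaling of `Q`, `R` and of
`β`).  Only the constant is defined here. [cite: VairinhosDeforcrand2014, §"0-link action", eq. (Z, 0-link)] -/
def vdfNormalisation (N : ℕ) (β : Plaquette d L → ℝ) : ℝ :=
  ∏ p : Plaquette d L,
    (2 : ℝ) ^ (N ^ 2) * Real.pi⁻¹ ^ (3 * N ^ 2) * (β p)⁻¹ ^ (N ^ 2) * Real.exp (-(2 * N * (β p + 1)))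

/-- `N₀(β) > 0` for positive couplings. [folklore] -/
theorem vdfNormalisation_pos {β : Plaquette d L → ℝ} (hβ : ∀ p, 0 < β p) :
    0 < vdfNormalisation (d := d) (L := L) N β := by
  unfold vdfNormalisation
  refine Finset.prod_pos fun p _ => ?_
  have h1 : 0 < (β p)⁻¹ := inv_pos.2 (hβ p)
  positivity

/-- The Gaussian weight is positive. [folklore] -/
theorem vdfGaussWeight_pos (β : Plaquette d L → ℝ) (X : VdFConfig d L N) : 0 < vdfGaussWeight β X :=
  Finset.prod_pos fun _ _ => Real.exp_pos _

/-- The dual weight is non-negative (for any `ρ`). [folklore] -/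
theorem vdfDensity_nonneg (β : Plaquette d L → ℝ) (X : VdFConfig d L N) : 0 ≤ vdfDensity ρ β X :=
  mul_nonneg (vdfGaussWeight_pos β X).le (Finset.prod_nonneg fun _ _ => oneLinkIntegral_nonneg ρ _)

/-- The dual weight is positive for continuous `ρ`: the link-free representation has no sign
problem in the pure-gauge sector. [cite: VairinhosDeforcrand2014, §"0-link action"] -/
theorem vdfDensity_pos (hρ : Continuous ρ) (β : Plaquette d L → ℝ) (X : VdFConfig d L N) :
    0 < vdfDensity ρ β X :=
  mul_pos (vdfGaussWeight_pos β X) (Finset.prod_pos fun _ _ => oneLinkIntegral_pos ρ hρ _)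

omit [NeZero L] in
/-- Each matrix-valued field `X ↦ Q_p(X)` (and `R_p`, `R'_p`) is continuous. [folklore] -/
theorem VdFConfig.continuous_fields (p : Plaquette d L) :
    Continuous (fun X : VdFConfig d L N => X.Q p) ∧ Continuous (fun X : VdFConfig d L N => X.R p) ∧
      Continuous (fun X : VdFConfig d L N => X.R' p) := by
  exact ⟨continuous_matrix fun _ _ => continuous_apply _,
    continuous_matrix fun _ _ => continuous_apply _, continuous_matrix fun _ _ => continuous_apply _⟩

/-- The source `X ↦ J_ℓ(X)` is continuous (a polynomial in the entries). [folklore] -/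
theorem VdFConfig.continuous_source (ℓ : Edge d L) :
    Continuous fun X : VdFConfig d L N => X.source ℓ := by
  unfold VdFConfig.source
  refine continuous_finsetSum _ fun p _ => ?_
  obtain ⟨hQ, hR, hR'⟩ := VdFConfig.continuous_fields (N := N) p
  refine ((Continuous.add ?_ ?_).add ?_).add ?_
  · split_ifs
    · exact hR.matrix_mul hQ.matrix_conjTranspose
    · exact continuous_const
  · split_ifs
    · exact hR.matrix_conjTranspose
    · exact continuous_const
  · split_ifs
    · exact hR'.matrix_mul hQ.matrix_conjTranspose
    · exact continuous_const
  · split_ifs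
    · exact hR'.matrix_conjTranspose
    · exact continuous_const

/-- The Gaussian weight is continuous. [folklore] -/
theorem continuous_vdfGaussWeight (β : Plaquette d L → ℝ) :
    Continuous fun X : VdFConfig d L N => vdfGaussWeight β X := by
  unfold vdfGaussWeight VdFConfig.plaqEnergy
  refine continuous_finsetProd _ fun p _ => Real.continuous_exp.comp (Continuous.neg ?_)
  obtain ⟨hQ, hR, hR'⟩ := VdFConfig.continuous_fields (N := N) p
  have tr : ∀ {F : VdFConfig d L N → Matrix (Fin N) (Fin N) ℂ}, Continuous F →
      Continuous fun X => ((F X)ᴴ * F X).trace.re := fun hF =>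
    Complex.continuous_re.comp (hF.matrix_conjTranspose.matrix_mul hF).matrix_trace
  exact ((continuous_const.mul (tr hQ)).add (tr hR)).add (tr hR')

/-- The dual weight is continuous for continuous `ρ`, hence Borel measurable. [folklore] -/
theorem continuous_vdfDensity (hρ : Continuous ρ) (β : Plaquette d L → ℝ) :
    Continuous fun X : VdFConfig d L N => vdfDensity ρ β X := by
  unfold vdfDensity
  exact (continuous_vdfGaussWeight β).mul (continuous_finsetProd _ fun ℓ _ =>
    (continuous_oneLinkIntegral ρ hρ).comp (VdFConfig.continuous_source ℓ))

/-- Measurability of the dual weight for continuous `ρ`. [folklore] -/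
theorem measurable_vdfDensity (hρ : Continuous ρ) (β : Plaquette d L → ℝ) :
    Measurable fun X : VdFConfig d L N => vdfDensity ρ β X :=
  (continuous_vdfDensity ρ hρ β).measurable

/-- The dual measure of a measurable set is the Lebesgue integral of the dual weight over it.
[folklore] -/
theorem vdfDualMeasure_apply (β : Plaquette d L → ℝ) {s : Set (VdFConfig d L N)}
    (hs : MeasurableSet s) :
    vdfDualMeasure ρ β s = ∫⁻ X in s, ENNReal.ofReal (vdfDensity ρ β X) :=
  withDensity_apply _ hs

/-- The dual partition function as a Lebesgue integral over all auxiliary fields. [folklore] -/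
theorem vdfDualPartition_eq (β : Plaquette d L → ℝ) :
    vdfDualPartition (d := d) (L := L) ρ β = ∫⁻ X, ENNReal.ofReal (vdfDensity ρ β X) := by
  rw [vdfDualPartition, vdfDualMeasure_apply ρ β MeasurableSet.univ, Measure.restrict_univ]

/-- `Z_dual > 0` for continuous `ρ`: the dual weight is an everywhere-positive continuous density
against Lebesgue measure, so the dual measure is a genuine non-zero measure. [folklore] -/
theorem vdfDualPartition_pos (hρ : Continuous ρ) (β : Plaquette d L → ℝ) :
    0 < vdfDualPartition (d := d) (L := L) ρ β := by
  rw [vdfDualPartition_eq, lintegral_pos_iff_support (measurable_vdfDensity ρ hρ β).ennreal_ofReal]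
  have h : Function.support (fun X : VdFConfig d L N => ENNReal.ofReal (vdfDensity ρ β X)) =
      Set.univ := by
    ext X
    simp [vdfDensity_pos ρ hρ β X]
  rw [h]
  exact Measure.measure_univ_pos.mpr (NeZero.ne _)

/-- The dual measure is absolutely continuous with respect to Lebesgue measure. [folklore] -/
theorem vdfDualMeasure_absolutelyContinuous (β : Plaquette d L → ℝ) :
    vdfDualMeasure (d := d) (L := L) ρ β ≪ volume :=
  withDensity_absolutelyContinuous _ _

end Dual

end Literature.MathematicalPhysics.QuantumLattice
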